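import Literature.Probability.LatticeModels.LebowitzPairTruncationIsing
import Literature.Probability.LatticeModels.CriticalUrsellFourFloor
import Literature.Probability.LatticeModels.CriticalCorrWellDefined
import Summits.CriticalPhenomena.Ising3DConformalLimit.Theses.HyperoctahedralRP
import HarnessLib

/-!
# Pair truncation in the scaling limit of the critical `ℤ³` correlators: stub
# `stub_pairTruncation` of line `free-endpoint-gaussian-closure` for crux
# `InversionUpgradeNormalised` (stmt-CriticalPhenomena-1982)

Statement.  Let `S` be a pointwise scaling limit (`HasPointwiseScalingLimit`) of the critical Ising
correlators `criticalCorr 3` on `ℤ³` under a renormalisation `ρ` (positive on `(0,1]`; positivity is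
not used).  For even `p, q` and an injective appended configuration `(x, y)`,
`x : Fin p → ℝ³`, `y : Fin q → ℝ³`:

* (GKS II) `0 ≤ S_{p+q}(x,y) - S_p(x) S_q(y)`;
* (Glimm–Jaffe, Cor. 4.3.3)
  `2 (S_{p+q}(x,y) - S_p(x) S_q(y)) ≤ Σ_{I ⊆ [p] odd} Σ_{J ⊆ [q] odd} S(x_I, y_J) S(x_{Iᶜ}, y_{Jᶜ})`,
  the sub-configurations being enumerated increasingly (`Finset.orderEmbOfFin`).

Proof.
* LATTICE, lower bound (any sites, coincidences allowed): the spin monomials of `u`, `w` are spin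
  products `σ_A`, `σ_B` of the odd-multiplicity sets (`exists_spinMonomial_eq_spinProduct`), the
  monomial of `Fin.append u w` is `σ_A σ_B = σ_{A ∆ B}`, and GKS II for the plus state at `β_c ≥ 0`,
  `h = 0` (`plusCorr_mul_le`, Friedli–Velenik 2017, Thm. 3.20) gives
  `G_p(u) G_q(w) ≤ G_{p+q}(u,w)` (`criticalCorr_mul_le_append`).
* LATTICE, upper bound (injective `Fin.append u w`): with `A = image u`, `B = image w` (cards `p`,
  `q`), `G_{p+q}(u,w) = ⟨σ_{A∆B}⟩⁺`, `G_p(u) = ⟨σ_A⟩⁺`, `G_q(w) = ⟨σ_B⟩⁺`, and the tree's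
  `plusCorr_two_mul_cov_le_sum_odd_of_free_eq_plus` (Glimm–Jaffe Cor. 4.3.3 in the plus state, which
  equals the free state at `β_c(3)` since `m*(β_c) = 0`:
  `freeCorr_eq_plusCorr_of_spontaneousMagnetization_eq_zero`,
  `spontaneousMagnetization_criticalBeta_eq_zero_holds`) bounds `2(⟨σ_{A∆B}⟩ - ⟨σ_A⟩⟨σ_B⟩)` by the
  sum over odd `A₁ ⊆ A`, `B₁ ⊆ B` of `⟨σ_{A₁∆B₁}⟩⟨σ_{(A∖A₁)∆(B∖B₁)}⟩`; the pairs `(A₁, B₁)` are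
  reindexed by pairs `(I, J)` of odd index sets through `I ↦ I.image u` (a card-preserving bijection,
  `u` injective), and `⟨σ_{I.image u ∆ J.image w}⟩ = G_{|I|+|J|}(u ∘ e_I, w ∘ e_J)` with `e_I` the
  increasing enumeration of `I` (`criticalCorr_two_mul_cov_le_sum_odd_index`).
* SCALING: at mesh `δ` multiply by `ρ(δ)^{p+q} = ρ^p ρ^q = ρ^{|I|+|J|} ρ^{|Iᶜ|+|Jᶜ|} ≥ 0` (even
  exponent); the lattice approximation of the injective `(x, y)` is injective for all small `δ`
  (`eventually_injective_latticeApprox`).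
* LIMIT `δ → 0⁺`: every configuration involved is injective (`Fin.append_injective_iff`), so
  `TendstoLocallyUniformlyOn.tendsto_at` applies termwise; `le_of_tendsto_of_tendsto`.

References: J. Glimm, A. Jaffe, *Quantum Physics* (2nd ed., 1987), §4.3, Cor. 4.3.3;
S. Friedli, Y. Velenik, *Statistical Mechanics of Lattice Systems* (CUP 2017), Thm. 3.20.
No definitions are introduced.
-/

noncomputable section

open Filter Topology
open scoped symmDiff
open Literature.Probability.LatticeModels

namespace Summit.CriticalPhenomena.Ising3DConformalLimit.Cruxes.InversionUpgradeNormalised.FreeEndpointGaussianClosure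

/-! ### Finite combinatorics of sub-configurations -/

/-- The sub-configuration of `u : Fin m → α` on `I ⊆ Fin m`, enumerated increasingly, has image
`I.image u`. -/
theorem image_univ_orderEmbOfFin_comp {α : Type*} [DecidableEq α] {m : ℕ} (u : Fin m → α)
    (I : Finset (Fin m)) :
    Finset.univ.image (fun i => u (I.orderEmbOfFin rfl i)) = I.image u := by
  ext v
  simp only [Finset.mem_image, Finset.mem_univ, true_and]
  constructor
  · rintro ⟨i, rfl⟩
    exact ⟨I.orderEmbOfFin rfl i, Finset.orderEmbOfFin_mem I rfl i, rfl⟩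
  · rintro ⟨k, hk, rfl⟩
    obtain ⟨i, hi⟩ : k ∈ Set.range (I.orderEmbOfFin rfl) := by
      rw [Finset.range_orderEmbOfFin, Finset.mem_coe]; exact hk
    exact ⟨i, by rw [hi]⟩

/-- For an injective `u : Fin m → α`, the image of the complement of `I` is the complement of the
image inside `image u`. -/
theorem image_compl_eq_sdiff {α : Type*} [DecidableEq α] {m : ℕ} {u : Fin m → α}
    (hu : Function.Injective u) (I : Finset (Fin m)) :
    Iᶜ.image u = Finset.univ.image u \ I.image u := by
  rw [Finset.compl_eq_univ_sdiff, Finset.image_sdiff _ _ hu]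

/-- For `A₁ ⊆ image u`, the indices mapped into `A₁` have image exactly `A₁`. -/
theorem image_filter_mem_eq {α : Type*} [DecidableEq α] {m : ℕ} (u : Fin m → α) {A₁ : Finset α}
    (h : A₁ ⊆ Finset.univ.image u) :
    (Finset.univ.filter fun i => u i ∈ A₁).image u = A₁ := by
  ext v
  simp only [Finset.mem_image, Finset.mem_filter, Finset.mem_univ, true_and]
  constructor
  · rintro ⟨i, hi, rfl⟩
    exact hi
  · intro hv
    obtain ⟨i, -, rfl⟩ := Finset.mem_image.mp (h hv)
    exact ⟨i, hv, rfl⟩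

/-! ### Lattice input: GKS II and Glimm–Jaffe Cor. 4.3.3 for `criticalCorr 3` on appended
configurations -/

/-- **GKS II for the critical correlators on appended configurations** (arbitrary sites,
coincidences allowed): `⟨∏ᵢ σ_{uᵢ}⟩_{β_c} ⟨∏ⱼ σ_{wⱼ}⟩_{β_c} ≤ ⟨∏ᵢ σ_{uᵢ} ∏ⱼ σ_{wⱼ}⟩_{β_c}`.  The spin
monomials are spin products `σ_A`, `σ_B`, `σ_{A∆B}` of the odd-multiplicity sets and the second
Griffiths inequality holds for the plus state at `β_c ≥ 0`, `h = 0` (Friedli–Velenik 2017, Thm. 3.20,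
in the infinite-volume limit: `plusCorr_mul_le`). -/
theorem criticalCorr_mul_le_append {m n : ℕ} (u : Fin m → Site 3) (w : Fin n → Site 3) :
    criticalCorr 3 m u * criticalCorr 3 n w ≤ criticalCorr 3 (m + n) (Fin.append u w) := by
  -- adapted from Theorems/HyperoctahedralRPInversionUpgradeNormalisedEvenPos.lean
  -- `criticalCorr_split_le`
  classical
  obtain ⟨A, hA⟩ := exists_spinMonomial_eq_spinProduct u
  obtain ⟨B, hB⟩ := exists_spinMonomial_eq_spinProduct w
  have h : spinMonomial (Fin.append u w) = spinProduct (A ∆ B) := by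
    rw [spinMonomial_append]
    funext s
    rw [hA, hB, spinProduct_mul_spinProduct]
  show plusExpect 3 (criticalBeta 3) 0 (spinMonomial u) *
      plusExpect 3 (criticalBeta 3) 0 (spinMonomial w) ≤
    plusExpect 3 (criticalBeta 3) 0 (spinMonomial (Fin.append u w))
  rw [hA, hB, h]
  exact plusCorr_mul_le (criticalBeta_nonneg 3) le_rfl A B

/-- The critical correlator of an INJECTIVE configuration is the plus-state correlation of its
image: `⟨∏ᵢ σ_{zᵢ}⟩_{β_c} = ⟨σ_{image z}⟩⁺_{β_c,0}`. -/
theorem criticalCorr_eq_plusCorr_image {n : ℕ} {z : Fin n → Site 3} (hz : Function.Injective z) :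
    criticalCorr 3 n z = plusCorr 3 (criticalBeta 3) 0 (Finset.univ.image z) := by
  show plusExpect 3 (criticalBeta 3) 0 (spinMonomial z) = _
  rw [spinMonomial_eq_spinProduct_image' hz]
  rfl

/-- The critical correlator of an appended pair of injective configurations is the plus-state
correlation of the symmetric difference of the images (`σ_A σ_B = σ_{A∆B}`). -/
theorem criticalCorr_append_eq_plusCorr {m n : ℕ} (a : Fin m → Site 3) (b : Fin n → Site 3)
    (ha : Function.Injective a) (hb : Function.Injective b) :
    criticalCorr 3 (m + n) (Fin.append a b) =
      plusCorr 3 (criticalBeta 3) 0 (Finset.univ.image a ∆ Finset.univ.image b) := by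
  have h : spinMonomial (Fin.append a b) =
      spinProduct (Finset.univ.image a ∆ Finset.univ.image b) := by
    rw [spinMonomial_append]
    funext s
    rw [spinMonomial_eq_spinProduct_image' ha, spinMonomial_eq_spinProduct_image' hb,
      spinProduct_mul_spinProduct]
  show plusExpect 3 (criticalBeta 3) 0 (spinMonomial (Fin.append a b)) = _
  rw [h]
  rfl

/-- The critical correlator of the appended sub-configurations `(u|_I, w|_J)` (increasing
enumerations) of injective `u`, `w` is `⟨σ_{I.image u ∆ J.image w}⟩⁺_{β_c,0}`. -/
theorem criticalCorr_subconfig_append {p q : ℕ} {u : Fin p → Site 3} {w : Fin q → Site 3}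
    (hu : Function.Injective u) (hw : Function.Injective w) (I : Finset (Fin p))
    (J : Finset (Fin q)) :
    criticalCorr 3 (I.card + J.card)
        (Fin.append (fun i => u (I.orderEmbOfFin rfl i)) (fun j => w (J.orderEmbOfFin rfl j))) =
      plusCorr 3 (criticalBeta 3) 0 (I.image u ∆ J.image w) := by
  rw [criticalCorr_append_eq_plusCorr (fun i => u (I.orderEmbOfFin rfl i))
      (fun j => w (J.orderEmbOfFin rfl j)) (hu.comp (I.orderEmbOfFin rfl).injective)
      (hw.comp (J.orderEmbOfFin rfl).injective),
    image_univ_orderEmbOfFin_comp, image_univ_orderEmbOfFin_comp]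

/-- **Glimm–Jaffe Cor. 4.3.3 for the critical correlators, index form.**  For even `p, q` and an
injective appended lattice configuration `Fin.append u w`,
`2 (G_{p+q}(u,w) - G_p(u) G_q(w)) ≤ Σ_{I ⊆ [p] odd} Σ_{J ⊆ [q] odd} G(u_I, w_J) G(u_{Iᶜ}, w_{Jᶜ})`,
`G = criticalCorr 3`: the tree's set-indexed bound `plusCorr_two_mul_cov_le_sum_odd_of_free_eq_plus`
(plus = free at `β_c(3)` by `m*(β_c) = 0`) on `A = image u`, `B = image w`, with the odd subsets
`A₁ ⊆ A`, `B₁ ⊆ B` reindexed by odd index sets through the injections `u`, `w`. -/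
theorem criticalCorr_two_mul_cov_le_sum_odd_index {p q : ℕ} (hp : Even p) (hq : Even q)
    {u : Fin p → Site 3} {w : Fin q → Site 3} (h : Function.Injective (Fin.append u w)) :
    2 * (criticalCorr 3 (p + q) (Fin.append u w) - criticalCorr 3 p u * criticalCorr 3 q w) ≤
      ∑ I ∈ (Finset.univ : Finset (Fin p)).powerset.filter (fun I => Odd I.card),
        ∑ J ∈ (Finset.univ : Finset (Fin q)).powerset.filter (fun J => Odd J.card),
          criticalCorr 3 (I.card + J.card)
              (Fin.append (fun i => u (I.orderEmbOfFin rfl i)) (fun j => w (J.orderEmbOfFin rfl j))) *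
            criticalCorr 3 (Iᶜ.card + Jᶜ.card)
              (Fin.append (fun i => u (Iᶜ.orderEmbOfFin rfl i))
                (fun j => w (Jᶜ.orderEmbOfFin rfl j))) := by
  obtain ⟨hu, hw, -⟩ := Fin.append_injective_iff.mp h
  have hA : Even (Finset.univ.image u).card := by
    rwa [Finset.card_image_of_injective _ hu, Finset.card_univ, Fintype.card_fin]
  have hB : Even (Finset.univ.image w).card := by
    rwa [Finset.card_image_of_injective _ hw, Finset.card_univ, Fintype.card_fin]
  have hfp : ∀ X : Finset (Site 3), freeCorr 3 (criticalBeta 3) 0 X = plusCorr 3 (criticalBeta 3) 0 X :=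
    fun X => freeCorr_eq_plusCorr_of_spontaneousMagnetization_eq_zero (criticalBeta_nonneg 3)
      (spontaneousMagnetization_criticalBeta_eq_zero_holds (d := 3) (by norm_num)) X
  have hmain := plusCorr_two_mul_cov_le_sum_odd_of_free_eq_plus (criticalBeta_nonneg 3) hfp hA hB
  rw [criticalCorr_append_eq_plusCorr u w hu hw, criticalCorr_eq_plusCorr_image hu,
    criticalCorr_eq_plusCorr_image hw]
  refine hmain.trans (le_of_eq ?_)
  rw [← Finset.sum_product']
  symm
  refine Finset.sum_nbij' (fun IJ => (IJ.1.image u, IJ.2.image w))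
    (fun AB => (Finset.univ.filter fun i => u i ∈ AB.1, Finset.univ.filter fun j => w j ∈ AB.2))
    ?_ ?_ ?_ ?_ ?_
  · intro IJ hIJ
    simp only [Finset.mem_product, Finset.mem_filter, Finset.mem_powerset] at hIJ ⊢
    rw [Finset.card_image_of_injective _ hu, Finset.card_image_of_injective _ hw]
    exact ⟨⟨Finset.image_subset_image (Finset.subset_univ _),
      Finset.image_subset_image (Finset.subset_univ _)⟩, hIJ.1.2, hIJ.2.2⟩
  · intro AB hAB
    simp only [Finset.mem_product, Finset.mem_filter, Finset.mem_powerset] at hAB ⊢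
    refine ⟨⟨Finset.subset_univ _, ?_⟩, Finset.subset_univ _, ?_⟩
    · rw [← Finset.card_image_of_injective _ hu, image_filter_mem_eq u hAB.1.1]
      exact hAB.2.1
    · rw [← Finset.card_image_of_injective _ hw, image_filter_mem_eq w hAB.1.2]
      exact hAB.2.2
  · intro IJ _
    refine Prod.ext ?_ ?_
    · ext i
      simp only [Finset.mem_filter, Finset.mem_univ, true_and]
      exact hu.mem_finset_image
    · ext j
      simp only [Finset.mem_filter, Finset.mem_univ, true_and]
      exact hw.mem_finset_image
  · intro AB hAB
    simp only [Finset.mem_product, Finset.mem_filter, Finset.mem_powerset] at hAB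
    exact Prod.ext (image_filter_mem_eq u hAB.1.1) (image_filter_mem_eq w hAB.1.2)
  · intro IJ _
    rw [criticalCorr_subconfig_append hu hw IJ.1 IJ.2,
      criticalCorr_subconfig_append hu hw IJ.1ᶜ IJ.2ᶜ, image_compl_eq_sdiff hu,
      image_compl_eq_sdiff hw]

/-! ### Rescaling at mesh `δ` -/

/-- The lattice approximation of an appended configuration is the appended lattice
approximation. -/
theorem latticeApprox_append {m n : ℕ} (δ : ℝ) (a : Fin m → EuclideanSpace ℝ (Fin 3))
    (b : Fin n → EuclideanSpace ℝ (Fin 3)) :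
    (fun k => latticeApprox δ (Fin.append a b k)) =
      Fin.append (fun i => latticeApprox δ (a i)) (fun j => latticeApprox δ (b j)) := by
  funext k
  refine Fin.addCases (fun i => ?_) (fun j => ?_) k
  · simp only [Fin.append_left]
  · simp only [Fin.append_right]

/-- `|I| + |J| + |Iᶜ| + |Jᶜ| = p + q` for `I ⊆ Fin p`, `J ⊆ Fin q`. -/
theorem card_add_card_add_compl (p q : ℕ) (I : Finset (Fin p)) (J : Finset (Fin q)) :
    I.card + J.card + (Iᶜ.card + Jᶜ.card) = p + q := by
  have h1 := I.card_add_card_compl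
  have h2 := J.card_add_card_compl
  rw [Fintype.card_fin] at h1 h2
  omega

/-- **GKS II for the rescaled correlators** at every mesh `δ`: for `p + q` even (so that
`ρ(δ)^{p+q} = ρ(δ)^p ρ(δ)^q ≥ 0`),
`(ρ^p G_p[x/δ]) (ρ^q G_q[y/δ]) ≤ ρ^{p+q} G_{p+q}[(x,y)/δ]`. -/
theorem rescaledCorrelator_mul_le_append (ρ : ℝ → ℝ) {p q : ℕ} (hpq : Even (p + q)) (δ : ℝ)
    (x : Fin p → EuclideanSpace ℝ (Fin 3)) (y : Fin q → EuclideanSpace ℝ (Fin 3)) :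
    rescaledCorrelator (criticalCorr 3) ρ p δ x * rescaledCorrelator (criticalCorr 3) ρ q δ y ≤
      rescaledCorrelator (criticalCorr 3) ρ (p + q) δ (Fin.append x y) := by
  simp only [rescaledCorrelator_apply, latticeApprox_append]
  have key := criticalCorr_mul_le_append (fun i => latticeApprox δ (x i)) (fun j => latticeApprox δ (y j))
  have hρ0 : 0 ≤ ρ δ ^ (p + q) := hpq.pow_nonneg _
  calc ρ δ ^ p * criticalCorr 3 p (fun i => latticeApprox δ (x i)) *
        (ρ δ ^ q * criticalCorr 3 q (fun j => latticeApprox δ (y j)))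
      = ρ δ ^ (p + q) * (criticalCorr 3 p (fun i => latticeApprox δ (x i)) *
          criticalCorr 3 q (fun j => latticeApprox δ (y j))) := by
        rw [pow_add]; ring
    _ ≤ ρ δ ^ (p + q) * criticalCorr 3 (p + q)
          (Fin.append (fun i => latticeApprox δ (x i)) (fun j => latticeApprox δ (y j))) :=
        mul_le_mul_of_nonneg_left key hρ0

/-- **Glimm–Jaffe Cor. 4.3.3 for the rescaled correlators** at a mesh `δ` at which the lattice
approximation of `(x, y)` is injective (`p, q` even): the index-form lattice bound
`criticalCorr_two_mul_cov_le_sum_odd_index` multiplied by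
`ρ(δ)^{p+q} = ρ^{|I|+|J|} ρ^{|Iᶜ|+|Jᶜ|} ≥ 0`. -/
theorem rescaledCorrelator_two_mul_cov_le_sum_odd (ρ : ℝ → ℝ) {p q : ℕ} (hp : Even p) (hq : Even q)
    (δ : ℝ) (x : Fin p → EuclideanSpace ℝ (Fin 3)) (y : Fin q → EuclideanSpace ℝ (Fin 3))
    (hδ : Function.Injective fun k => latticeApprox δ (Fin.append x y k)) :
    2 * (rescaledCorrelator (criticalCorr 3) ρ (p + q) δ (Fin.append x y) -
          rescaledCorrelator (criticalCorr 3) ρ p δ x * rescaledCorrelator (criticalCorr 3) ρ q δ y) ≤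
      ∑ I ∈ (Finset.univ : Finset (Fin p)).powerset.filter (fun I => Odd I.card),
        ∑ J ∈ (Finset.univ : Finset (Fin q)).powerset.filter (fun J => Odd J.card),
          rescaledCorrelator (criticalCorr 3) ρ (I.card + J.card) δ
              (Fin.append (fun i => x (I.orderEmbOfFin rfl i)) (fun j => y (J.orderEmbOfFin rfl j))) *
            rescaledCorrelator (criticalCorr 3) ρ (Iᶜ.card + Jᶜ.card) δ
              (Fin.append (fun i => x (Iᶜ.orderEmbOfFin rfl i))
                (fun j => y (Jᶜ.orderEmbOfFin rfl j))) := by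
  rw [latticeApprox_append] at hδ
  have key := mul_le_mul_of_nonneg_left (criticalCorr_two_mul_cov_le_sum_odd_index hp hq hδ)
    ((hp.add hq).pow_nonneg (ρ δ))
  simp only [rescaledCorrelator_apply, latticeApprox_append]
  refine le_trans (le_of_eq ?_) (key.trans (le_of_eq ?_))
  · rw [pow_add]; ring
  · rw [Finset.mul_sum]
    refine Finset.sum_congr rfl fun I _ => ?_
    rw [Finset.mul_sum]
    refine Finset.sum_congr rfl fun J _ => ?_
    rw [← card_add_card_add_compl p q I J, pow_add]
    ring

/-! ### The registered stub -/

/-- **stub_pairTruncation** (GKS II and the Glimm–Jaffe pair-truncation tree bound in the scaling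
limit).  For every pointwise scaling limit `S` of `criticalCorr 3` (renormalisation `ρ > 0` on
`(0,1]`), even `p, q` and an injective appended configuration `(x, y)`:
`0 ≤ S_{p+q}(x,y) - S_p(x) S_q(y)` and
`2 (S_{p+q}(x,y) - S_p(x) S_q(y)) ≤ Σ_{I ⊆ [p] odd} Σ_{J ⊆ [q] odd} S_{|I|+|J|}(x_I, y_J) S(x_{Iᶜ}, y_{Jᶜ})`
(sub-configurations enumerated increasingly by `Finset.orderEmbOfFin`).  The rescaled lattice
inequalities (`rescaledCorrelator_mul_le_append` at every mesh;
`rescaledCorrelator_two_mul_cov_le_sum_odd` at every mesh with injective lattice approximation,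
i.e. eventually, `eventually_injective_latticeApprox`) are passed to the limit `δ → 0⁺` termwise at
the injective sub-configurations (`Fin.append_injective_iff`, `TendstoLocallyUniformlyOn.tendsto_at`,
`le_of_tendsto_of_tendsto`).  Glimm–Jaffe 1987, Cor. 4.3.3; Friedli–Velenik 2017, Thm. 3.20. -/
theorem stub_pairTruncation :
    ∀ (ρ : ℝ → ℝ) (S : CorrFamily 3), (∀ δ ∈ Set.Ioc (0:ℝ) 1, 0 < ρ δ) →
      HasPointwiseScalingLimit (criticalCorr 3) ρ S →
      ∀ (p q : ℕ) (x : Fin p → EuclideanSpace ℝ (Fin 3)) (y : Fin q → EuclideanSpace ℝ (Fin 3)),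
        Even p → Even q → Function.Injective (Fin.append x y) →
        0 ≤ S (p + q) (Fin.append x y) - S p x * S q y ∧
        2 * (S (p + q) (Fin.append x y) - S p x * S q y) ≤
          ∑ I ∈ (Finset.univ : Finset (Fin p)).powerset.filter (fun I => Odd I.card),
            ∑ J ∈ (Finset.univ : Finset (Fin q)).powerset.filter (fun J => Odd J.card),
              S (I.card + J.card)
                  (Fin.append (fun i => x (I.orderEmbOfFin rfl i)) (fun j => y (J.orderEmbOfFin rfl j))) *
                S (Iᶜ.card + Jᶜ.card)
                  (Fin.append (fun i => x (Iᶜ.orderEmbOfFin rfl i)) (fun j => y (Jᶜ.orderEmbOfFin rfl j))) := by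
  intro ρ S _hρ hlim p q x y hp hq hinj
  obtain ⟨hx, hy, hxy⟩ := Fin.append_injective_iff.mp hinj
  -- every appended sub-configuration is injective
  have hsub : ∀ (I : Finset (Fin p)) (J : Finset (Fin q)),
      Function.Injective
        (Fin.append (fun i => x (I.orderEmbOfFin rfl i)) (fun j => y (J.orderEmbOfFin rfl j))) :=
    fun I J => Fin.append_injective_iff.mpr ⟨hx.comp (I.orderEmbOfFin rfl).injective,
      hy.comp (J.orderEmbOfFin rfl).injective, fun i j => hxy _ _⟩
  -- the limits of the rescaled correlators at the injective configurations
  have hTxy : Tendsto (fun δ => rescaledCorrelator (criticalCorr 3) ρ (p + q) δ (Fin.append x y))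
      (𝓝[>] 0) (𝓝 (S (p + q) (Fin.append x y))) := (hlim (p + q)).tendsto_at hinj
  have hTx : Tendsto (fun δ => rescaledCorrelator (criticalCorr 3) ρ p δ x) (𝓝[>] 0)
      (𝓝 (S p x)) := (hlim p).tendsto_at hx
  have hTy : Tendsto (fun δ => rescaledCorrelator (criticalCorr 3) ρ q δ y) (𝓝[>] 0)
      (𝓝 (S q y)) := (hlim q).tendsto_at hy
  refine ⟨sub_nonneg.mpr (le_of_tendsto_of_tendsto' (hTx.mul hTy) hTxy fun δ =>
    rescaledCorrelator_mul_le_append ρ (hp.add hq) δ x y), ?_⟩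
  refine le_of_tendsto_of_tendsto ((hTxy.sub (hTx.mul hTy)).const_mul 2)
    (tendsto_finsetSum _ fun I _ => tendsto_finsetSum _ fun J _ =>
      ((hlim _).tendsto_at (hsub I J)).mul ((hlim _).tendsto_at (hsub Iᶜ Jᶜ))) ?_
  filter_upwards [eventually_injective_latticeApprox (d := 3) (by norm_num) hinj] with δ hδ
  exact rescaledCorrelator_two_mul_cov_le_sum_odd ρ hp hq δ x y hδ

end Summit.CriticalPhenomena.Ising3DConformalLimit.Cruxes.InversionUpgradeNormalised.FreeEndpointGaussianClosure

end
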